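import Summits.BirchSwinnertonDyer.Rank1Residual.X9.GaloisShear
import Literature.NumberTheory.EllipticCurves.Rank1Residual.X9SmallImage
import Literature.NumberTheory.EllipticCurves.BSDSelmerPConverseSerreProofs
import Literature.NumberTheory.GaloisRepresentations.AbsGaloisGroupCompact
import HarnessLib

/-!
# Class X9 / partition finding F2: `surj(p) ∧ p ≥ 5 ⟹ (im)` — the surjective cell carries
# Burungale–Castella–Skinner's hypothesis (im) (cell `b2b-bsdres`, unit `b2b-bsdres-x9`, gen 9)

HONEST FRAMING (run/shared/lean/b2b/bsd-rank1-residual/, verbatim in every file): the goal of the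
cell is to DELETE the COMBINATION-SHAPED residual classes of the Birch–Swinnerton-Dyer formula for
ALL analytic-rank `≤ 1` elliptic curves over `ℚ` — "full BSD formula for every rank `≤ 1` curve in
class `C`" assembled STRICTLY from published theorems — so that the rank-`≤ 1` remainder becomes
exactly the CONSTRUCTION-SHAPED classes, which are TYPED (missing-input `Prop`s), NOT attempted.
This is not "finishing BSD". Nothing below is a class theorem; X9 stays typed
(`Literature/…/Rank1Residual/Typed/X9.lean`); no named fact is introduced (theorems only).

## What this module proves (our own work, hence `Summits/`)

`bigIm_of_hasSurjectiveModNGaloisRep_pow` (every prime `p`: all `ρ̄_{E,p^n}` onto ⟹ (im)) and its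
corollary `bigIm_of_surj`: for an elliptic curve `E = W/ℚ` and a prime `p ≥ 5`, if the mod-`p` Galois
representation `ρ̄_{E,p} : Γ_ℚ → Aut(E[p])` is surjective (`Surj W p`) then hypothesis (im) of
Burungale–Castella–Skinner, IMRN 2025, p. 2 (= Kato 2004 Thm. 13.4 (3); Skinner 2016 §2.5 (b))
holds LITERALLY as the tree states it (`BigIm W p`, `Rank1Residual/Predicates.lean`): there is a
`σ ∈ Γ_ℚ` fixing every `p`-power root of unity of `ℚ̄` with `T_pE/(σ - 1)T_pE ≃ ℤ_p`
(`T_pE = W.tateModule p`, `σ - 1 = W.galoisRepTate p σ - id`).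

With the X9 prover's earlier `not_bigIm_of_irr_of_not_surj` (`X9SmallImage.lean`: irr ∧ ¬surj ⟹
¬(im), every `p`) this gives the dichotomy `bigIm_iff_surj_of_irr` (`p ≥ 5`, `E[p]` irreducible:
(im) ⟺ surj) and the emptiness of the partition's finding-F2 shape `surj(p) ∧ ¬(im)` at `p ≥ 5`
(`not_surj_and_not_bigIm`; `Summits/…/Rank1Residual/Partition.lean`, referee acceptance point 10,
R86.4: "F2 is either closed by a lemma `Surj W p → BigIm W p` (`p ≥ 5`) with a source, or left as an
explicitly named empty cell").  The consequence for the partition — the printed class `ClassX9im`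
EQUALS the tree's `ClassX9` on real curves, so the residual disjunction needs no `X9im` — is the
sibling module `Summits/BirchSwinnertonDyer/Rank1Residual/X9/PartitionF2.lean`.

## Proof (all inputs are tree THEOREMS; standard axioms)

(1) `#E[p^k] = p^{2k}` (`card_torsionPoints_eq_sq_holds`) gives `a, b ∈ T_pE` with bijective level
maps `(x, y) ↦ x a_k + y b_k : (ℤ/p^k)² → E[p^k]` and `ℤ_p² ≅ T_pE` (`TateModuleProofs`).
(2) `C_n = {σ ∈ Γ_ℚ | σ a_n = a_n, σ b_n = a_n + b_n}` is CLOSED (stabilisers of geometric points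
are open, `isOpen_stabilizer_point_holds`), NON-EMPTY (Serre's lifting lemma at level `p^n`, tree
theorem `serre_hasSurjectiveModNGaloisRep_pow_holds` = Serre 1968 IV-23 Lemma 3, `p ≥ 5`: the
shear is an automorphism of `E[p^n]`, hence some `ρ̄_{E,p^n}(σ)`) and DECREASING; `Γ_ℚ` is compact
(`absoluteGaloisGroup_compactSpace`), so some `σ` lies in every `C_n`: `σ a = a`, `σ b = a + b`.
(3) `σ` fixes `μ_{p^n}`: for the Weil pairing (`exists_weilPairing_holds`), `ζ = e(a_n, b_n)` is
`σ`-invariant and a PRIMITIVE `p^n`-th root of unity by non-degeneracy (`det ρ̄ = χ` for the shear).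
(4) In the basis `a, b`, `σ - 1` is `x a + y b ↦ y a`, whose range is the kernel of the onto
functional `x a + y b ↦ y`; so `T/(σ - 1)T ≃ ℤ_p`.  This is the classical "`p ≥ 5`, `ρ̄` onto ⟹
`ρ_{E,p^∞}(Γ_ℚ) = GL₂(ℤ_p) ∋ (1 1; 0 1)`" (Serre; BCS 2025 Rem. 1.1.3; RESIDUAL-CASES §a.0 "(im) ⇐
surj(p), p ≥ 5") carried out on the tree's concrete Tate module.

## References

* [BurungaleCastellaSkinner2025] A. Burungale, F. Castella, C. Skinner, IMRN 2025 (rnaf082) =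
  arXiv:2405.00270v2, p. 2 hypothesis (im), Rem. 1.1.3 (i), (iii).
* [SerreAbelianLadic1968] J.-P. Serre, *Abelian `ℓ`-adic representations and elliptic curves* (1968),
  Ch. IV §3.4 Lemma 3 (tree: `GaloisRepresentations/SerreSL2Lifting.lean`,
  `EllipticCurves/BSDSelmerPConverseSerreProofs.lean`).
* [Serre1972] J.-P. Serre, Invent. Math. 15 (1972), §4.
* [SilvermanAEC2009] J. H. Silverman, *AEC*, III.6.4, III.7.1, III.8.1.
-/

noncomputable section

open scoped Classical

open WeierstrassCurve Field Literature.NumberTheory.EllipticCurves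
  Literature.NumberTheory.EllipticCurves.Rank1Residual Literature.NumberTheory.GaloisRepresentations

namespace Summit.BirchSwinnertonDyer.Rank1Residual.X9

/-! ### Over `ℚ`, `p ≥ 5`: surj ⟹ (im) -/

section Rat

variable (W : WeierstrassCurve ℚ) [W.IsElliptic] (p : ℕ) [Fact p.Prime]

/-- **`p`-adic surjectivity ⟹ (im), for EVERY prime `p`.**  For an elliptic curve `E = W/ℚ` and
a prime `p` with `ρ̄_{E,p^n} : Γ_ℚ → Aut(E[p^n])` surjective for every `n` (i.e. `ρ_{E,p^∞}` onto
`GL₂(ℤ_p)`), Burungale–Castella–Skinner's hypothesis (im) holds LITERALLY: there is `σ ∈ Γ_ℚ`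
fixing all `p`-power roots of unity (`σ ∈ G_{ℚ(μ_{p^∞})}`) with `T_pE/(σ - 1)T_pE ≃ ℤ_p`.
Proof: compactness of `Γ_ℚ` (a `σ` acting as the shear `a ↦ a, b ↦ a + b` on a `ℤ_p`-basis of
`T_pE`, the level-`p^n` shears being realised by surjectivity), and the Weil pairing (`σ` fixes
`μ_{p^∞}`); see the module docstring.  This is the classical witness "`τ = (1 1; 0 1) ∈ SL₂(ℤ_p) =
ρ_E(G_{ℚ(μ_{p^∞})})`" by which the tree's Yan–Zhu / Kim / BCS facts read (Im) from `p`-adic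
surjectivity (e.g. `YanZhu2026.thm415_padicValRat_bsd_rank_le_one`'s first image alternative),
now a theorem about `BigIm` itself. [folklore] -/
theorem bigIm_of_hasSurjectiveModNGaloisRep_pow
    (hsurj : ∀ n : ℕ, W.HasSurjectiveModNGaloisRep (p ^ n : ℕ)) : BigIm W p := by
  have hp : p.Prime := Fact.out
  have hpQ : (p : ℚ) ≠ 0 := Nat.cast_ne_zero.mpr hp.ne_zero
  -- torsion counts `#E[p^k] = p^{2k}`
  have hc : ∀ k : ℕ, Nat.card (geomTorsion W ((p ^ k : ℕ) : ℤ)) = p ^ (2 * k) :=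
    card_geomTorsion_pow_eq W p (card_torsionPoints_eq_sq_holds W (AlgebraicClosure ℚ)) hpQ
  -- a `ℤ_p`-basis `a, b` of `T_p E` with bijective level maps
  obtain ⟨P₁, hP₁, Q₁, hQ₁, hgen₁⟩ :=
    TateModule.exists_generators_of_card_torsionBy (A := geomPoints W) (p := p) (by simpa using hc 1)
  have hs := TateModule.exists_smul_eq_of_card_torsionBy (A := geomPoints W) hc
  obtain ⟨a, ha⟩ := TateModule.exists_proj_one_eq (A := geomPoints W) (fun k P hP ↦ hs k hP) hP₁
  obtain ⟨b, hb⟩ := TateModule.exists_proj_one_eq (A := geomPoints W) (fun k P hP ↦ hs k hP) hQ₁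
  have hgen : ∀ R ∈ geomTorsion W ((p : ℕ) : ℤ), ∃ m n : ℤ,
      m • TateModule.proj p 1 a + n • TateModule.proj p 1 b = R := by
    rw [ha, hb]; exact hgen₁
  have hlev : ∀ k, Function.Bijective (TateModule.levelMap p a b k) :=
    TateModule.levelMap_bijective a b hc hgen
  have hpair : Function.Bijective (TateModule.pairMap a b) :=
    TateModule.pairMap_bijective_of_levelMap_bijective a b hlev
  -- the closed sets `C n = {σ | σ a_n = a_n, σ b_n = a_n + b_n}`
  let C : ℕ → Set (absoluteGaloisGroup ℚ) := fun n ↦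
    {σ | σ • TateModule.proj p n a = TateModule.proj p n a} ∩
      {σ | σ • TateModule.proj p n b = TateModule.proj p n a + TateModule.proj p n b}
  have hCmem : ∀ n σ, σ ∈ C n ↔ σ • TateModule.proj p n a = TateModule.proj p n a ∧
      σ • TateModule.proj p n b = TateModule.proj p n a + TateModule.proj p n b :=
    fun n σ ↦ Iff.rfl
  have hCclosed : ∀ n, IsClosed (C n) := fun n ↦
    (isClosed_setOf_smul_point_eq W _ _).inter (isClosed_setOf_smul_point_eq W _ _)
  have hCanti : ∀ n, C (n + 1) ⊆ C n := by
    intro n σ hσ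
    rw [hCmem] at hσ ⊢
    obtain ⟨h1, h2⟩ := hσ
    constructor
    · rw [← TateModule.smul_proj_succ n a, smul_comm σ p, h1]
    · rw [← TateModule.smul_proj_succ n b, smul_comm σ p, h2, smul_add, TateModule.smul_proj_succ,
        TateModule.smul_proj_succ]
  have hCne : ∀ n, (C n).Nonempty := by
    intro n
    cases n with
    | zero =>
      refine ⟨1, ?_⟩
      rw [hCmem, TateModule.proj_zero, TateModule.proj_zero, one_smul, add_zero]
      exact ⟨rfl, rfl⟩
    | succ k =>
      have hm : 2 ≤ p ^ (k + 1) := hp.two_le.trans (Nat.le_self_pow k.succ_ne_zero p)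
      obtain ⟨σ, hσ⟩ := exists_smul_eq_shear_of_hasSurjectiveModNGaloisRep W hm (hsurj (k + 1))
        (TateModule.proj_mem_torsionBy (k + 1) a) (TateModule.proj_mem_torsionBy (k + 1) b)
        (TateModule.levelMap p a b (k + 1)) (fun xy ↦ TateModule.coe_levelMap a b (k + 1) xy)
        (hlev (k + 1))
      exact ⟨σ, (hCmem _ σ).mpr hσ⟩
  -- compactness of `Γ_ℚ`: some `σ` lies in every `C n`
  haveI : CompactSpace (absoluteGaloisGroup ℚ) := absoluteGaloisGroup_compactSpace ℚ
  obtain ⟨σ, hσ⟩ := IsCompact.nonempty_iInter_of_sequence_nonempty_isCompact_isClosed C hCanti hCne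
    (hCclosed 0).isCompact hCclosed
  rw [Set.mem_iInter] at hσ
  have hσn : ∀ n, σ • TateModule.proj p n a = TateModule.proj p n a ∧
      σ • TateModule.proj p n b = TateModule.proj p n a + TateModule.proj p n b :=
    fun n ↦ (hCmem n σ).mp (hσ n)
  -- `σ a = a`, `σ b = a + b` in `T_p E`
  have hσa : σ • a = a := TateModule.ext fun n ↦ by
    rw [TateModule.proj_smul_of_distribMulAction]; exact (hσn n).1
  have hσb : σ • b = a + b := TateModule.ext fun n ↦ by
    rw [TateModule.proj_smul_of_distribMulAction, map_add]; exact (hσn n).2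
  refine ⟨σ, ?_, ?_⟩
  · -- `σ` fixes the `p`-power roots of unity
    intro ζ n hζ
    change σ • ζ = ζ
    cases n with
    | zero =>
      rw [pow_zero, pow_one] at hζ
      rw [hζ, smul_one]
    | succ k =>
      have hm : 2 ≤ p ^ (k + 1) := hp.two_le.trans (Nat.le_self_pow k.succ_ne_zero p)
      have hmQ : ((p ^ (k + 1) : ℕ) : ℚ) ≠ 0 := by exact_mod_cast pow_ne_zero _ hp.ne_zero
      exact smul_eq_self_of_pow_eq_one_of_shear W hm hmQ (TateModule.proj_mem_torsionBy (k + 1) a)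
        (TateModule.proj_mem_torsionBy (k + 1) b) (TateModule.levelMap p a b (k + 1))
        (fun xy ↦ TateModule.coe_levelMap a b (k + 1) xy) (hlev (k + 1)) (hσn (k + 1)).1
        (hσn (k + 1)).2 (by exact_mod_cast hζ)
  · -- `T/(σ - 1)T ≃ ℤ_p`: in the basis `a, b`, `σ - 1` is `x a + y b ↦ y a`
    let Φ : (ℤ_[p] × ℤ_[p]) ≃ₗ[ℤ_[p]] W.tateModule p :=
      LinearEquiv.ofBijective (TateModule.pairMap a b) hpair
    have hΦ : ∀ x y : ℤ_[p], Φ (x, y) = x • a + y • b := fun x y ↦ by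
      rw [LinearEquiv.ofBijective_apply, TateModule.pairMap_apply]
    let lam : W.tateModule p →ₗ[ℤ_[p]] ℤ_[p] :=
      (LinearMap.snd ℤ_[p] ℤ_[p] ℤ_[p]).comp Φ.symm.toLinearMap
    have hlam : ∀ x y : ℤ_[p], lam (x • a + y • b) = y := fun x y ↦ by
      change (Φ.symm (x • a + y • b)).2 = y
      rw [← hΦ, LinearEquiv.symm_apply_apply]
    have hsurjl : Function.Surjective lam := fun y ↦ ⟨(0 : ℤ_[p]) • a + y • b, hlam 0 y⟩
    have hρ : ∀ x y : ℤ_[p],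
        (W.galoisRepTate p σ - LinearMap.id : W.tateModule p →ₗ[ℤ_[p]] W.tateModule p)
          (x • a + y • b) = y • a + (0 : ℤ_[p]) • b := by
      intro x y
      rw [LinearMap.sub_apply, LinearMap.id_apply, map_add, map_smul, map_smul,
        galoisRepTate_apply_apply, galoisRepTate_apply_apply, hσa, hσb, smul_add, zero_smul, add_zero]
      abel
    have hker : LinearMap.range (W.galoisRepTate p σ - LinearMap.id) = LinearMap.ker lam := by
      apply le_antisymm
      · rintro _ ⟨t, rfl⟩
        obtain ⟨⟨x, y⟩, rfl⟩ := hpair.2 t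
        rw [LinearMap.mem_ker, TateModule.pairMap_apply, hρ, hlam]
      · intro t ht
        obtain ⟨⟨x, y⟩, rfl⟩ := hpair.2 t
        rw [LinearMap.mem_ker, TateModule.pairMap_apply, hlam] at ht
        refine ⟨(0 : ℤ_[p]) • a + x • b, ?_⟩
        rw [hρ, TateModule.pairMap_apply, ht]
    exact ⟨(Submodule.quotEquivOfEq _ _ hker).trans (LinearMap.quotKerEquivOfSurjective lam hsurjl)⟩

/-- **`surj(p) ∧ p ≥ 5 ⟹ (im).`**  For `p ≥ 5`, surjectivity of the mod-`p` representation
already gives (im): Serre's lifting lemma (tree theorem `serre_hasSurjectiveModNGaloisRep_pow_holds`,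
Serre 1968 IV-23 Lemma 3) makes every `ρ̄_{E,p^n}` onto, and
`bigIm_of_hasSurjectiveModNGaloisRep_pow` applies.  This is the remark "(im) ⇐ surj(p) for
`p ≥ 5`" used by RESIDUAL-CASES §a.0 (row `T-BCS`) and implicit in BCS 2025 Rem. 1.1.3; it closes
finding F2 of the cell's partition lemma. [folklore] -/
theorem bigIm_of_surj (h5 : 5 ≤ p) (hsurj : Surj W p) : BigIm W p :=
  bigIm_of_hasSurjectiveModNGaloisRep_pow W p (serre_hasSurjectiveModNGaloisRep_pow_holds W p h5 hsurj)

/-- **At an irreducible prime `p ≥ 5`: (im) ⟺ surj(p).**  `←` is `bigIm_of_surj`; `→` is the X9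
prover's `surj_of_irr_of_bigIm` (`X9SmallImage.lean`: a `σ ∈ G_{ℚ(μ_{p^∞})}` with
`T/(σ-1)T ≃ ℤ_p` acts on `E[p]` by a transvection of order `p`, and Serre 1972 Prop. 15 makes an
irreducible image containing a transvection everything).  So on the grid of the partition lemma
the atoms `surj` and `im` coincide on every irreducible cell with `p ≥ 5`. [folklore] -/
theorem bigIm_iff_surj_of_irr (h5 : 5 ≤ p) (hirr : Irr W p) : BigIm W p ↔ Surj W p :=
  ⟨surj_of_irr_of_bigIm W p hirr, bigIm_of_surj W p h5⟩

/-- **Finding F2 of the partition lemma is an EMPTY cell**: at `p ≥ 5` no elliptic curve over `ℚ`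
has `ρ̄_{E,p}` surjective and (im) false.  (`Summits/…/Rank1Residual/Partition.lean`, finding F2;
referee acceptance point 10, R86.4.) [folklore] -/
theorem not_surj_and_not_bigIm (h5 : 5 ≤ p) : ¬ (Surj W p ∧ ¬ BigIm W p) :=
  fun h ↦ h.2 (bigIm_of_surj W p h5 h.1)

/-- **The printed X9 condition `¬(im)` equals the census reading `¬surj(p)` at an irreducible
`p ≥ 5`** (RESIDUAL-CASES §a.2 row X9: "`irr(p) ∧ ¬(im) [census: ¬surj(p)]`"): the bracket is not
a proxy but an equivalence. [folklore] -/
theorem not_bigIm_iff_not_surj_of_irr (h5 : 5 ≤ p) (hirr : Irr W p) : ¬ BigIm W p ↔ ¬ Surj W p :=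
  not_congr (bigIm_iff_surj_of_irr W p h5 hirr)

end Rat

end Summit.BirchSwinnertonDyer.Rank1Residual.X9
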